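import Summits.ValiantsHypothesis.ValiantsHypothesis.Theorems.LangWeilTransferAssemblyModP
import Literature.Computability.AlgebraicComplexity.SharpPBitsPPolyModP
import Literature.Computability.AlgebraicComplexity.ValiantConjectureEquivProofs

/-!
# LangWeilTransfer, item `Assembly` (stmt-ValiantsHypothesis-6382) — PROVED

Route `LangWeilTransfer` of `ValiantsHypothesis`, assembly item:
`ShatteringExclusion → TameTransfer → ScalarRestriction → SharpPNotPPoly → ValiantsHypothesis`.

Proof (the route's "Contrapositive re-assembly of Bürgisser's (A3) pipeline with Thm 4.1 replaced"):
if `VP_ℂ = VNP_ℂ` then `per` is p-computable (`isPComputable_perPoly_complex_iff`), so `per_n` has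
fan-in-two circuits of size `≤ n^c` (`exists_circuits_of_isPComputable`); the algebraic core
`modP_per_of_cruxes` (AssemblyModP: coefficient ideal of the skeleton → `TameTransfer` → point over
`GaloisField p r` → skeleton specialised there → `ScalarRestriction`) gives, for all large `n`, a prime
`2^{n+1} < p ≤ 2^{(n+2)^e}` with `L_{ℤ/p}(per_n) ≤ (n+2)^e`; small `n` are served by Bertrand primes and
the trivial circuit (`complexity_perPoly_le_factorial`); packaged p-boundedly
(`per_modP_of_cruxes`) this is exactly the hypothesis of the tree's Boolean tail
`PSharpP_subset_PPoly_of_modP_perPoly` (bits of `per` over small prime fields ⇒ `P^{#P} ⊆ P/poly`),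
contradicting `SharpPNotPPoly`.

Honest framing: the route stays CONDITIONAL — its cruxes `ShatteringExclusion`, `GoodReduction`,
`TameResolution` (feeding `TameTransfer` via the landed `TransferGlue`) and `P^#P ⊄ P/poly` are open;
with this file `valiantsHypothesis_of_open_items` no longer needs the assembly as a hypothesis.
`VP ≠ VNP` is NOT proved and nothing here is progress on it.

## References

* P. Bürgisser, *Cook's versus Valiant's hypothesis*, TCS 235 (2000), Cor 1.2, Thm 4.1, §5 (A3).
  [cite: Burgisser2000TCS, §5 (A3)]
-/

-- the summit and the problem share the name `ValiantsHypothesis` (D-0017 single-conjunct layout)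
set_option linter.dupNamespace false

noncomputable section

open MvPolynomial

namespace Summit.ValiantsHypothesis.ValiantsHypothesis.Theorems.LangWeilTransfer

open Summit.ValiantsHypothesis.ValiantsHypothesis.Theses.LangWeilTransfer
open Literature.Computability.AlgebraicComplexity Literature.Computability.Complexity ArithCircuit

/-- p-computability of `per` gives fan-in-two circuits of size `≤ n^{2c₀+1}` for `n ≥ 2`. [folklore] -/
theorem exists_circuits_of_isPComputable (h : IsPComputable fun n => perPoly (Fin n) ℂ) :
    ∃ c : ℕ, ∀ n, 2 ≤ n → ∃ P : ArithCircuit ℂ (Fin n × Fin n),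
      P.IsFanInTwo ∧ P.size ≤ n ^ c ∧ P.Computes (perPoly (Fin n) ℂ) := by
  obtain ⟨c₀, hc₀⟩ := h
  refine ⟨2 * c₀ + 1, fun n hn => ?_⟩
  obtain ⟨P, hP2, hPc, hPs⟩ := exists_computes_size_eq_complexity (perPoly (Fin n) ℂ)
  refine ⟨P, hP2, ?_, hPc⟩
  rw [hPs]
  refine (hc₀ n).trans ?_
  have h1 : c₀ ≤ n ^ c₀ := (Nat.lt_two_pow_self).le.trans (Nat.pow_le_pow_left hn c₀)
  have h2 : 1 ≤ n ^ c₀ := Nat.one_le_pow _ _ (by omega)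
  calc n ^ c₀ + c₀ ≤ n ^ c₀ * n ^ c₀ * n := by nlinarith
    _ = n ^ (2 * c₀ + 1) := by rw [← pow_add, ← pow_succ]; ring_nf

/-- **`per` cheap modulo small primes, for EVERY `n`, p-boundedly** (large `n`: `modP_per_of_cruxes`;
small `n`: a Bertrand prime and the trivial circuit). [cite: Burgisser2000TCS, §5 (A3)] -/
theorem per_modP_of_cruxes (hSE : ShatteringExclusion) (hTT : TameTransfer)
    (hSR : ScalarRestriction) (hPC : IsPComputable fun n => perPoly (Fin n) ℂ) :
    ∃ a b : ℕ, ∀ N : ℕ, ∃ p : ℕ, p.Prime ∧ 2 ^ N < p ∧ p ≤ 2 ^ (N ^ a + a) ∧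
      complexity (perPoly (Fin N) (ZMod p)) ≤ N ^ b + b := by
  obtain ⟨c, hc⟩ := exists_circuits_of_isPComputable hPC
  obtain ⟨e, N₀, hbig⟩ := modP_per_of_cruxes hSE hTT hSR hc
  -- p-bounded envelopes covering both regimes
  set H : ℕ := N₀.factorial * (N₀ + 1) + N₀.factorial with hH
  have hR : IsPBounded fun N => (N + 2) ^ e + (N + 1) :=
    IsPBounded.add_holds (IsPBounded.pow_holds (IsPBounded.add_holds IsPBounded.id (IsPBounded.const 2)) e)
      (IsPBounded.add_holds IsPBounded.id (IsPBounded.const 1))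
  have hS : IsPBounded fun N => (N + 2) ^ e + H :=
    IsPBounded.add_holds (IsPBounded.pow_holds (IsPBounded.add_holds IsPBounded.id (IsPBounded.const 2)) e)
      (IsPBounded.const H)
  obtain ⟨a, ha⟩ := hR
  obtain ⟨b, hb⟩ := hS
  refine ⟨a, b, fun N => ?_⟩
  by_cases hN : N₀ ≤ N
  · obtain ⟨p, r, hp, hT, hr, hpr, hcx⟩ := hbig N hN
    refine ⟨p, hp, ?_, ?_, ?_⟩
    · calc 2 ^ N ≤ 2 ^ (N + 1) := Nat.pow_le_pow_right (by norm_num) (by omega)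
        _ < p := hT
    · calc p ≤ p ^ r := Nat.le_self_pow (by omega) p
        _ ≤ 2 ^ ((N + 2) ^ e) := hpr
        _ ≤ 2 ^ (N ^ a + a) := Nat.pow_le_pow_right (by norm_num) ((Nat.le_add_right _ _).trans (ha N))
    · exact hcx.trans ((Nat.le_add_right _ _).trans (hb N))
  · push Not at hN
    obtain ⟨p, hp, hlt, hle⟩ := Nat.exists_prime_lt_and_le_two_mul (2 ^ N) (by positivity)
    refine ⟨p, hp, hlt, ?_, ?_⟩
    · calc p ≤ 2 * 2 ^ N := hle
        _ = 2 ^ (N + 1) := by rw [pow_succ]; ring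
        _ ≤ 2 ^ (N ^ a + a) := Nat.pow_le_pow_right (by norm_num) ((Nat.le_add_left _ _).trans (ha N))
    · have hfac : N.factorial ≤ N₀.factorial := Nat.factorial_le hN.le
      calc complexity (perPoly (Fin N) (ZMod p)) ≤ N.factorial * (N + 1) + N.factorial :=
            complexity_perPoly_le_factorial N
        _ ≤ H := add_le_add (Nat.mul_le_mul hfac (by omega)) hfac
        _ ≤ (N + 2) ^ e + H := Nat.le_add_left _ _
        _ ≤ N ^ b + b := hb N

/-- **Item `Assembly` of route LangWeilTransfer (stmt-ValiantsHypothesis-6382):**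
`ShatteringExclusion → TameTransfer → ScalarRestriction → SharpPNotPPoly → ValiantsHypothesis`.
By contraposition through `per_modP_of_cruxes` and the Boolean tail
`PSharpP_subset_PPoly_of_modP_perPoly`. [cite: Burgisser2000TCS, §5 (A3)] -/
theorem assembly_proof : Summit.ValiantsHypothesis.ValiantsHypothesis.Theses.LangWeilTransfer.Assembly := by
  intro hSE hTT hSR hSharp
  by_contra hVH
  have hEq : VP ℂ = VNP ℂ := by
    unfold ValiantsHypothesis Literature.PNP.ValiantHypothesis at hVH
    exact of_not_not hVH
  have hPC : IsPComputable fun n => perPoly (Fin n) ℂ := isPComputable_perPoly_complex_iff.2 hEq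
  obtain ⟨a, b, hper⟩ := per_modP_of_cruxes hSE hTT hSR hPC
  exact hSharp (PSharpP_subset_PPoly_of_modP_perPoly (a := a) (b := b) hper)

end Summit.ValiantsHypothesis.ValiantsHypothesis.Theorems.LangWeilTransfer

end
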